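import Summits.QuantumFields.BalabanUV.Beta.D1BFx.ResolventWeightUnfold

/-!
# `BalabanUV.Beta.D1BFx.LocalisedFrameBlocks` — road «BF-x» for binder row D1, slot (K), row **(K8-L)(d2-b)(i) THE LOCALISED FRAME `𝔅`,
# BLOCK BY BLOCK** (owner d1-p2-g8, `K-END-RECUT-SPEC.md` §8 (U1)∘(U2), journal 2026-08-21 l.27484): the road instantiation of
# `ResolventWeightUnfold.det_fromBlocks_zaux` (p249228) ∘ `ProjectorWeightUnfold.det_aug_eq_det_gram_mul_det_kkt` (p249004) —
# `det 𝔅 = (−1)^{|σ|} · det(X)² · det(c·(X⁻¹N)ᵀ(X⁻¹N)) · det kkt (K + c·D·R·Dᵀ) Q`, `R = 1 − M(MᵀM)⁻¹Mᵀ`, `M = X⁻¹N`,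
# where `𝔅` is the bordered matrix `[[K+cDDᵀ, Qᵀ, 0, −cD, 0],[Q,0,0,0,0],[0,0,0,0,−Q′],[−cDᵀ,0,0,c·1,X],[0,0,−Q′ᵀ,X,0]]` (`N = Q′ᵀ`) whose every
# block is one of the road's LOCAL letters `K, Q, D, X, N, c•1, 0`.

HONEST DEPENDENCY (cell records, verbatim): «continuum YM on T⁴ ⇐ BetaPertH ∧ nine spine estimates (0/9 proved); BetaPertH ⇐ (D1) ∧ (D4) ∧
CAP+tail; G-an2-4 gates asym, D1 and NE2/3/4.»  HONEST FRAMING (cell contract, verbatim): «discharging `BetaPertH` makes Bałaban's UV stability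
UNCONDITIONAL — a real constructive-QFT result; it is NOT the continuum limit and NOT the Clay problem.»  THIS MODULE DISCHARGES NOTHING of (K),
of D1 or of the wall: [folklore] block bookkeeping (Mathlib `fromBlocks`∕`fromRows`∕`fromCols` products) over the two landed identities
`ResolventWeightUnfold.det_fromBlocks_zaux` and `ProjectorWeightUnfold.det_aug_eq_det_gram_mul_det_kkt` BY NAME and the tree's `Beta.Composition.kkt`.
No definition, no `def … : Prop`, nothing cited, no wall binder instantiated, 0 sorry.  NOT D1, NOT BetaPertH, NOT continuum, NOT Clay.

ABSOLUTE RULE (cell charter, verbatim): «No internally-minted statement may enter as a cited fact. Every hypothesis is either kernel-proved in this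
package or a verbatim quotation of a PUBLISHED theorem with page reference. The manuscript(s) under audit are NOT citable for their own disputed
steps — they are the thing under adjudication; programme-internal (2001/route/tribunal) claims are never citable.»

WHY (`K-END-RECUT-SPEC.md` §8, F-g8-3 «LOCALISATION BY AUXILIARY FIELDS»).  Under the (R1-L) organisation the gluon N-side of road BF-x carries Bałaban's
R-weight `c·D_U·R_U·D_U*`, `R_U = 1 − M(MᵀM)⁻¹Mᵀ`, `M = G′_UQ′ᵀ`, `G′_U = (L_U + aQ′ᵀQ′)⁻¹`.  Two exact Gaussian un-foldings remove every non-local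
kernel from the quadratic form: (U1) `ProjectorWeightUnfold` (p249004) trades the projector for an auxiliary block variable `η` and the coarse Gram
`det(c·MᵀM)`; (U2) `ResolventWeightUnfold` (p249228) trades the resolvent `X⁻¹ = G′_U` inside the coupling for an auxiliary pair `(φ, ψ)` and the tower
`det(X)²`, in ABSTRACT Schur form (`A`, `E`, `F`, `X`).  This file is the ROAD INSTANTIATION the owner left to the consumer (l.27449∕l.27484): with
`A₀ := [[kkt (K + c•DDᵀ) Q, 0],[0, 0_m]]`, `E := [−c•D; 0; 0]`, `F := [0; 0; −Nᵀ]` the Schur complement `A₀ − F·X⁻¹·Eᵀ − E·X⁻¹·Fᵀ + c•(F·X⁻¹·X⁻¹·Fᵀ)` of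
(U2) IS, block by block, the `η`-augmented matrix of (U1) at `M := X⁻¹N` (§1, the one place where the symmetry of `X = L_U + aQ′ᵀQ′` enters is
`(X⁻¹N)ᵀ = NᵀX⁻¹`), whence `det 𝔅 = (−1)^{|σ|}·det(X)²·det(c·(X⁻¹N)ᵀ(X⁻¹N))·det kkt (K + c·D·R·Dᵀ) Q` (§3) and, over `ℝ`, the functional form
`log|det 𝔅| = 2·log|det X| + log|det(c·(X⁻¹N)ᵀ(X⁻¹N))| + log|det kkt (K + c·DRDᵀ) Q|` (§4) = §8's «`h_N^{cov} = h[𝔅_U] − 2h[X_U] − h[Q′X_U⁻²Q′ᵀ]`» at the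
log-det level: the one-loop functional of the R-weighted N-side is that of a bordered system whose blocks are LOCAL letters, minus two explicit towers.
CONTENT (field `𝕜`; `ν` fields, `μ` constraints, `σ` gauge parameters, `m` blocks; `K : ν×ν`, `Q : μ×ν`, `D : ν×σ`, `X : σ×σ`, `N : σ×m`, `c : 𝕜`;
index order of `𝔅`: `((a ⊕ λ_Q) ⊕ η) ⊕ (φ ⊕ ψ)`; the letters `A₀`, `E`, `F`, `𝔅` are SPELLED OUT in every statement — no abbreviation is defined):
* §1 [folklore] bookkeeping, no hypotheses: `couplings_eq_fromBlocks`, `couplingsT_eq_fromBlocks`, `frame_eq_fromBlocks` (`𝔅` in pure `fromBlocks` form),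
  **`schur_eq`** (the Schur complement of (U2) computed blockwise, symmetry not used), `schur_eq_aug` (`Xᵀ = X`: it is (U1)'s matrix at `M := X⁻¹N`).
* §2 [folklore] **`det_frame`** (`det X` a unit, `c ≠ 0`): `det 𝔅 = (−1)^{|σ|}·det(X)²·det(schur_eq's right side)`; `det_frame_aug` (`Xᵀ = X`).
* §3 [folklore] **`det_frame_eq_det_kkt`** (`Xᵀ = X`, `det X` a unit, `c ≠ 0`, `det(NᵀX⁻¹X⁻¹N)` a unit): the owner's displayed (d2-b)(i) equation.
* §4 [folklore] over `ℝ`: **`log_absDet_frame`**.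
NOT HERE ((d2-b)(ii), (d2-c)…(d2-e)): the closed-form blocks of `𝔅₀⁻¹` at `U = 𝟙`, the local word list, the engine runs, the Λ ∕ `Q̇` groups.
Unit `b2b-balaban-beta-d1-formalise-leaf-03` (gen 10), claim «D1-BFx-K8L-d2b LOCALISED FRAME BLOCKS» (journal l.27508); road owner `b2b-balaban-beta-d1-p2`.
-/

namespace Summit.QuantumFields.BalabanUV.Beta.D1BFx.LocalisedFrameBlocks

open Matrix
open Literature.MathematicalPhysics.QuantumFieldTheory.Balaban1983to89.Beta.Composition (kkt)
open Summit.QuantumFields.BalabanUV.Beta.D1BFx.ProjectorWeightUnfold (det_aug_eq_det_gram_mul_det_kkt)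
open Summit.QuantumFields.BalabanUV.Beta.D1BFx.ResolventWeightUnfold (det_fromBlocks_zaux)

section Field

variable {𝕜 : Type*} [Field 𝕜]
variable {ν μ σ m : Type*} [Fintype ν] [Fintype μ] [Fintype σ] [Fintype m] [DecidableEq ν] [DecidableEq μ] [DecidableEq σ] [DecidableEq m]

/-! ## §1 Bookkeeping: the couplings and the Schur complement, block by block -/

omit [Fintype ν] [Fintype μ] [Fintype σ] [Fintype m] [DecidableEq ν] [DecidableEq μ] [DecidableEq σ] [DecidableEq m] in
/-- [folklore] The couplings `fromCols E F` of `(a ⊕ λ_Q) ⊕ η` to `φ ⊕ ψ` in `fromBlocks` form: `[[−c•D ⊕ 0, 0],[0, −Nᵀ]]`. -/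
theorem couplings_eq_fromBlocks (D : Matrix ν σ 𝕜) (N : Matrix σ m 𝕜) (c : 𝕜) :
    fromCols (fromRows (fromRows (-(c • D)) (0 : Matrix μ σ 𝕜)) (0 : Matrix m σ 𝕜))
        (fromRows (fromRows (0 : Matrix ν σ 𝕜) (0 : Matrix μ σ 𝕜)) (-Nᵀ))
      = fromBlocks (fromRows (-(c • D)) (0 : Matrix μ σ 𝕜)) (0 : Matrix (ν ⊕ μ) σ 𝕜) (0 : Matrix m σ 𝕜) (-Nᵀ) := by
  rw [fromCols_fromRows_eq_fromBlocks, fromRows_zero]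

omit [Fintype ν] [Fintype μ] [Fintype σ] [Fintype m] [DecidableEq ν] [DecidableEq μ] [DecidableEq σ] [DecidableEq m] in
/-- [folklore] The transposed couplings `fromRows Eᵀ Fᵀ` in `fromBlocks` form: `[[−c•Dᵀ | 0, 0],[0, −N]]`. -/
theorem couplingsT_eq_fromBlocks (D : Matrix ν σ 𝕜) (N : Matrix σ m 𝕜) (c : 𝕜) :
    fromRows (fromRows (fromRows (-(c • D)) (0 : Matrix μ σ 𝕜)) (0 : Matrix m σ 𝕜))ᵀ
        (fromRows (fromRows (0 : Matrix ν σ 𝕜) (0 : Matrix μ σ 𝕜)) (-Nᵀ))ᵀ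
      = fromBlocks (fromCols (-(c • Dᵀ)) (0 : Matrix σ μ 𝕜)) (0 : Matrix σ m 𝕜) (0 : Matrix σ (ν ⊕ μ) 𝕜) (-N) := by
  rw [transpose_fromRows, transpose_fromRows, transpose_fromRows, transpose_fromRows, fromRows_fromCols_eq_fromBlocks,
    transpose_zero, transpose_zero, transpose_zero, transpose_neg, transpose_neg, transpose_smul, transpose_transpose, fromCols_zero]

omit [Fintype ν] [Fintype μ] [Fintype m] [DecidableEq ν] [DecidableEq μ] [DecidableEq m] in
/-- [folklore] **THE FRAME `𝔅` IN PURE BLOCK FORM**: `𝔅 = [[A₀, [[−c•D ⊕ 0, 0],[0, −Nᵀ]]], [[[−c•Dᵀ | 0, 0],[0, −N]], [[c•1, X],[X, 0]]]]`, i.e. the display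
`[[K+cDDᵀ, Qᵀ, 0, −cD, 0],[Q,0,0,0,0],[0,0,0,0,−Nᵀ],[−cDᵀ,0,0,c·1,X],[0,0,−N,X,0]]` in the index order `((a ⊕ λ_Q) ⊕ η) ⊕ (φ ⊕ ψ)`. -/
theorem frame_eq_fromBlocks (K : Matrix ν ν 𝕜) (Q : Matrix μ ν 𝕜) (D : Matrix ν σ 𝕜) (X : Matrix σ σ 𝕜) (N : Matrix σ m 𝕜) (c : 𝕜) :
    fromBlocks
        (fromBlocks (kkt (K + c • (D * Dᵀ)) Q) (0 : Matrix (ν ⊕ μ) m 𝕜) (0 : Matrix m (ν ⊕ μ) 𝕜) (0 : Matrix m m 𝕜))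
        (fromCols (fromRows (fromRows (-(c • D)) (0 : Matrix μ σ 𝕜)) (0 : Matrix m σ 𝕜))
          (fromRows (fromRows (0 : Matrix ν σ 𝕜) (0 : Matrix μ σ 𝕜)) (-Nᵀ)))
        (fromRows (fromRows (fromRows (-(c • D)) (0 : Matrix μ σ 𝕜)) (0 : Matrix m σ 𝕜))ᵀ
          (fromRows (fromRows (0 : Matrix ν σ 𝕜) (0 : Matrix μ σ 𝕜)) (-Nᵀ))ᵀ)
        (fromBlocks (c • (1 : Matrix σ σ 𝕜)) X X 0)
      = fromBlocks
        (fromBlocks (kkt (K + c • (D * Dᵀ)) Q) (0 : Matrix (ν ⊕ μ) m 𝕜) (0 : Matrix m (ν ⊕ μ) 𝕜) (0 : Matrix m m 𝕜))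
        (fromBlocks (fromRows (-(c • D)) (0 : Matrix μ σ 𝕜)) (0 : Matrix (ν ⊕ μ) σ 𝕜) (0 : Matrix m σ 𝕜) (-Nᵀ))
        (fromBlocks (fromCols (-(c • Dᵀ)) (0 : Matrix σ μ 𝕜)) (0 : Matrix σ m 𝕜) (0 : Matrix σ (ν ⊕ μ) 𝕜) (-N))
        (fromBlocks (c • (1 : Matrix σ σ 𝕜)) X X 0) := by
  rw [couplings_eq_fromBlocks, couplingsT_eq_fromBlocks]

omit [Fintype ν] [Fintype μ] [Fintype m] [DecidableEq ν] [DecidableEq μ] [DecidableEq m] in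
/-- [folklore] **THE SCHUR COMPLEMENT OF (U2), BLOCK BY BLOCK** (no hypothesis; symmetry of `X` not used):
`A₀ − F·X⁻¹·Eᵀ − E·X⁻¹·Fᵀ + c•(F·X⁻¹·X⁻¹·Fᵀ) = [[kkt (K + c•DDᵀ) Q, [−c•D(X⁻¹N); 0]], [[−c•NᵀX⁻¹Dᵀ, 0], c•NᵀX⁻¹(X⁻¹N)]]`. -/
theorem schur_eq (K : Matrix ν ν 𝕜) (Q : Matrix μ ν 𝕜) (D : Matrix ν σ 𝕜) (X : Matrix σ σ 𝕜) (N : Matrix σ m 𝕜) (c : 𝕜) :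
    fromBlocks (kkt (K + c • (D * Dᵀ)) Q) (0 : Matrix (ν ⊕ μ) m 𝕜) (0 : Matrix m (ν ⊕ μ) 𝕜) (0 : Matrix m m 𝕜)
        - fromRows (fromRows (0 : Matrix ν σ 𝕜) (0 : Matrix μ σ 𝕜)) (-Nᵀ) * X⁻¹
            * (fromRows (fromRows (-(c • D)) (0 : Matrix μ σ 𝕜)) (0 : Matrix m σ 𝕜))ᵀ
        - fromRows (fromRows (-(c • D)) (0 : Matrix μ σ 𝕜)) (0 : Matrix m σ 𝕜) * X⁻¹
            * (fromRows (fromRows (0 : Matrix ν σ 𝕜) (0 : Matrix μ σ 𝕜)) (-Nᵀ))ᵀ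
        + c • (fromRows (fromRows (0 : Matrix ν σ 𝕜) (0 : Matrix μ σ 𝕜)) (-Nᵀ) * X⁻¹ * X⁻¹
            * (fromRows (fromRows (0 : Matrix ν σ 𝕜) (0 : Matrix μ σ 𝕜)) (-Nᵀ))ᵀ)
      = fromBlocks (kkt (K + c • (D * Dᵀ)) Q) (fromRows (-(c • (D * (X⁻¹ * N)))) (0 : Matrix μ m 𝕜))
          (fromCols (-(c • (Nᵀ * X⁻¹ * Dᵀ))) (0 : Matrix m μ 𝕜)) (c • (Nᵀ * X⁻¹ * (X⁻¹ * N))) := by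
  simp only [fromRows_zero, transpose_fromRows, transpose_zero, transpose_neg, transpose_smul, transpose_transpose]
  -- row-partition the three couplings-times-resolvent factors, then multiply out block by block (controlled order)
  rw [fromRows_mul (0 : Matrix (ν ⊕ μ) σ 𝕜) (-Nᵀ) X⁻¹, fromRows_mul (fromRows (-(c • D)) (0 : Matrix μ σ 𝕜)) (0 : Matrix m σ 𝕜) X⁻¹,
    fromRows_mul ((0 : Matrix (ν ⊕ μ) σ 𝕜) * X⁻¹) (-Nᵀ * X⁻¹) X⁻¹, fromRows_mul_fromCols, fromRows_mul_fromCols, fromRows_mul_fromCols]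
  simp only [Matrix.zero_mul, Matrix.mul_zero, mul_fromCols, fromRows_mul, Matrix.neg_mul, Matrix.mul_neg, neg_neg, Matrix.smul_mul,
    Matrix.mul_smul, fromBlocks_smul, smul_zero]
  rw [sub_eq_add_neg, sub_eq_add_neg, fromBlocks_neg, fromBlocks_neg, fromBlocks_add, fromBlocks_add, fromBlocks_add]
  simp only [neg_zero, neg_neg, smul_zero, add_zero, zero_add, fromRows_neg, fromCols_neg, Matrix.mul_assoc]

omit [Fintype ν] [Fintype μ] [Fintype m] [DecidableEq ν] [DecidableEq μ] [DecidableEq m] in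
/-- [folklore] **… AND IT IS (U1)'s `η`-AUGMENTED MATRIX AT `M := X⁻¹N`** (for `X` symmetric, `(X⁻¹N)ᵀ = NᵀX⁻¹`): the right side of `schur_eq` is literally
`ProjectorWeightUnfold`'s `fromBlocks (kkt (K + c•DDᵀ) Q) [−c•DM; 0] [−c•MᵀDᵀ | 0] (c•MᵀM)` at `M := X⁻¹N`. -/
theorem schur_eq_aug (K : Matrix ν ν 𝕜) (Q : Matrix μ ν 𝕜) (D : Matrix ν σ 𝕜) {X : Matrix σ σ 𝕜} (hX : Xᵀ = X) (N : Matrix σ m 𝕜) (c : 𝕜) :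
    fromBlocks (kkt (K + c • (D * Dᵀ)) Q) (0 : Matrix (ν ⊕ μ) m 𝕜) (0 : Matrix m (ν ⊕ μ) 𝕜) (0 : Matrix m m 𝕜)
        - fromRows (fromRows (0 : Matrix ν σ 𝕜) (0 : Matrix μ σ 𝕜)) (-Nᵀ) * X⁻¹
            * (fromRows (fromRows (-(c • D)) (0 : Matrix μ σ 𝕜)) (0 : Matrix m σ 𝕜))ᵀ
        - fromRows (fromRows (-(c • D)) (0 : Matrix μ σ 𝕜)) (0 : Matrix m σ 𝕜) * X⁻¹
            * (fromRows (fromRows (0 : Matrix ν σ 𝕜) (0 : Matrix μ σ 𝕜)) (-Nᵀ))ᵀ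
        + c • (fromRows (fromRows (0 : Matrix ν σ 𝕜) (0 : Matrix μ σ 𝕜)) (-Nᵀ) * X⁻¹ * X⁻¹
            * (fromRows (fromRows (0 : Matrix ν σ 𝕜) (0 : Matrix μ σ 𝕜)) (-Nᵀ))ᵀ)
      = fromBlocks (kkt (K + c • (D * Dᵀ)) Q) (fromRows (-(c • (D * (X⁻¹ * N)))) (0 : Matrix μ m 𝕜))
          (fromCols (-(c • ((X⁻¹ * N)ᵀ * Dᵀ))) (0 : Matrix m μ 𝕜)) (c • ((X⁻¹ * N)ᵀ * (X⁻¹ * N))) := by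
  have hMt : (X⁻¹ * N)ᵀ = Nᵀ * X⁻¹ := by rw [transpose_mul, transpose_nonsing_inv, hX]
  rw [schur_eq, hMt]

/-! ## §2 `det 𝔅` through the augmented matrix -/

/-- [folklore] **`det 𝔅 = (−1)^{|σ|} · det(X)² · det [[kkt (K + c•DDᵀ) Q, [−c•D(X⁻¹N); 0]], [[−c•NᵀX⁻¹Dᵀ, 0], c•NᵀX⁻¹(X⁻¹N)]]`** for `det X` a unit and
`c ≠ 0` — `ResolventWeightUnfold.det_fromBlocks_zaux` at the road's `A₀`, `E`, `F`, with the Schur complement read off by `schur_eq` (symmetry of `X` not used). -/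
theorem det_frame (K : Matrix ν ν 𝕜) (Q : Matrix μ ν 𝕜) (D : Matrix ν σ 𝕜) {X : Matrix σ σ 𝕜} (hXu : IsUnit X.det) (N : Matrix σ m 𝕜)
    {c : 𝕜} (hc : c ≠ 0) :
    (fromBlocks
        (fromBlocks (kkt (K + c • (D * Dᵀ)) Q) (0 : Matrix (ν ⊕ μ) m 𝕜) (0 : Matrix m (ν ⊕ μ) 𝕜) (0 : Matrix m m 𝕜))
        (fromCols (fromRows (fromRows (-(c • D)) (0 : Matrix μ σ 𝕜)) (0 : Matrix m σ 𝕜))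
          (fromRows (fromRows (0 : Matrix ν σ 𝕜) (0 : Matrix μ σ 𝕜)) (-Nᵀ)))
        (fromRows (fromRows (fromRows (-(c • D)) (0 : Matrix μ σ 𝕜)) (0 : Matrix m σ 𝕜))ᵀ
          (fromRows (fromRows (0 : Matrix ν σ 𝕜) (0 : Matrix μ σ 𝕜)) (-Nᵀ))ᵀ)
        (fromBlocks (c • (1 : Matrix σ σ 𝕜)) X X 0)).det
      = (-1) ^ Fintype.card σ * X.det ^ 2 *
        (fromBlocks (kkt (K + c • (D * Dᵀ)) Q) (fromRows (-(c • (D * (X⁻¹ * N)))) (0 : Matrix μ m 𝕜))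
          (fromCols (-(c • (Nᵀ * X⁻¹ * Dᵀ))) (0 : Matrix m μ 𝕜)) (c • (Nᵀ * X⁻¹ * (X⁻¹ * N)))).det := by
  rw [det_fromBlocks_zaux _ _ _ hXu hc, schur_eq]

/-- [folklore] The same with (U1)'s `η`-augmented matrix at `M := X⁻¹N` on the right (`X` symmetric). -/
theorem det_frame_aug (K : Matrix ν ν 𝕜) (Q : Matrix μ ν 𝕜) (D : Matrix ν σ 𝕜) {X : Matrix σ σ 𝕜} (hX : Xᵀ = X) (hXu : IsUnit X.det)
    (N : Matrix σ m 𝕜) {c : 𝕜} (hc : c ≠ 0) :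
    (fromBlocks
        (fromBlocks (kkt (K + c • (D * Dᵀ)) Q) (0 : Matrix (ν ⊕ μ) m 𝕜) (0 : Matrix m (ν ⊕ μ) 𝕜) (0 : Matrix m m 𝕜))
        (fromCols (fromRows (fromRows (-(c • D)) (0 : Matrix μ σ 𝕜)) (0 : Matrix m σ 𝕜))
          (fromRows (fromRows (0 : Matrix ν σ 𝕜) (0 : Matrix μ σ 𝕜)) (-Nᵀ)))
        (fromRows (fromRows (fromRows (-(c • D)) (0 : Matrix μ σ 𝕜)) (0 : Matrix m σ 𝕜))ᵀ
          (fromRows (fromRows (0 : Matrix ν σ 𝕜) (0 : Matrix μ σ 𝕜)) (-Nᵀ))ᵀ)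
        (fromBlocks (c • (1 : Matrix σ σ 𝕜)) X X 0)).det
      = (-1) ^ Fintype.card σ * X.det ^ 2 *
        (fromBlocks (kkt (K + c • (D * Dᵀ)) Q) (fromRows (-(c • (D * (X⁻¹ * N)))) (0 : Matrix μ m 𝕜))
          (fromCols (-(c • ((X⁻¹ * N)ᵀ * Dᵀ))) (0 : Matrix m μ 𝕜)) (c • ((X⁻¹ * N)ᵀ * (X⁻¹ * N)))).det := by
  rw [det_fromBlocks_zaux _ _ _ hXu hc, schur_eq_aug K Q D hX N c]

/-! ## §3 Composition with (U1): the owner's (d2-b)(i) equation -/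

/-- [folklore] **THE LOCALISED FRAME AT THE DETERMINANT LEVEL** (`K-END-RECUT-SPEC.md` §8 (U1)∘(U2); owner l.27484 token for token): for `X` symmetric with
`det X` a unit, `c ≠ 0` and `det(NᵀX⁻¹X⁻¹N)` a unit,
`det 𝔅 = (−1)^{|σ|} · det(X)² · det(c•(X⁻¹N)ᵀ(X⁻¹N)) · det kkt (K + c•D(1 − (X⁻¹N)((X⁻¹N)ᵀ(X⁻¹N))⁻¹(X⁻¹N)ᵀ)Dᵀ) Q` — the bordered determinant of `K` plus
Bałaban's projector weight `c·D·R·Dᵀ` (`R` the orthogonal projector onto `(range X⁻¹N)^⊥`, `X⁻¹N = G′_UQ′ᵀ`) equals `det 𝔅` with `𝔅`'s blocks the LOCAL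
letters `K, Q, D, X, N, c•1, 0`, divided by the two towers `det(X)²`, `det(c•(X⁻¹N)ᵀ(X⁻¹N))` and the sign `(−1)^{|σ|}`. -/
theorem det_frame_eq_det_kkt (K : Matrix ν ν 𝕜) (Q : Matrix μ ν 𝕜) (D : Matrix ν σ 𝕜) {X : Matrix σ σ 𝕜} (hX : Xᵀ = X) (hXu : IsUnit X.det)
    (N : Matrix σ m 𝕜) {c : 𝕜} (hc : c ≠ 0) (hG : IsUnit (Nᵀ * X⁻¹ * X⁻¹ * N).det) :
    (fromBlocks
        (fromBlocks (kkt (K + c • (D * Dᵀ)) Q) (0 : Matrix (ν ⊕ μ) m 𝕜) (0 : Matrix m (ν ⊕ μ) 𝕜) (0 : Matrix m m 𝕜))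
        (fromCols (fromRows (fromRows (-(c • D)) (0 : Matrix μ σ 𝕜)) (0 : Matrix m σ 𝕜))
          (fromRows (fromRows (0 : Matrix ν σ 𝕜) (0 : Matrix μ σ 𝕜)) (-Nᵀ)))
        (fromRows (fromRows (fromRows (-(c • D)) (0 : Matrix μ σ 𝕜)) (0 : Matrix m σ 𝕜))ᵀ
          (fromRows (fromRows (0 : Matrix ν σ 𝕜) (0 : Matrix μ σ 𝕜)) (-Nᵀ))ᵀ)
        (fromBlocks (c • (1 : Matrix σ σ 𝕜)) X X 0)).det
      = (-1) ^ Fintype.card σ * X.det ^ 2 * (c • ((X⁻¹ * N)ᵀ * (X⁻¹ * N))).det *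
        (kkt (K + c • (D * (1 - (X⁻¹ * N) * ((X⁻¹ * N)ᵀ * (X⁻¹ * N))⁻¹ * (X⁻¹ * N)ᵀ) * Dᵀ)) Q).det := by
  have hMt : (X⁻¹ * N)ᵀ = Nᵀ * X⁻¹ := by rw [transpose_mul, transpose_nonsing_inv, hX]
  have hG' : IsUnit ((X⁻¹ * N)ᵀ * (X⁻¹ * N)).det := by
    rw [hMt, ← Matrix.mul_assoc]; exact hG
  rw [det_frame_aug K Q D hX hXu N hc, det_aug_eq_det_gram_mul_det_kkt K Q D (X⁻¹ * N) hc hG']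
  simp only [mul_assoc]

end Field

/-! ## §4 Over `ℝ`: the functional (log-det) form -/

section Real

variable {ν μ σ m : Type*} [Fintype ν] [Fintype μ] [Fintype σ] [Fintype m] [DecidableEq ν] [DecidableEq μ] [DecidableEq σ] [DecidableEq m]

/-- [folklore] **LOG FORM** (`K-END-RECUT-SPEC.md` §8 «`h_N^{cov} = h[𝔅_U] − 2h[X_U] − h[Q′X_U⁻²Q′ᵀ]`» at the log-det level): for `X` symmetric, `c ≠ 0` and all
factors non-degenerate, `log|det 𝔅| = 2·log|det X| + log|det(c•(X⁻¹N)ᵀ(X⁻¹N))| + log|det kkt (K + c•D(1 − (X⁻¹N)((X⁻¹N)ᵀ(X⁻¹N))⁻¹(X⁻¹N)ᵀ)Dᵀ) Q|` —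
the one-loop functional of the R-weighted (R1-L) N-side is that of the LOCAL frame `𝔅` MINUS twice the massive covariant tower MINUS the coarse Gram tower. -/
theorem log_absDet_frame (K : Matrix ν ν ℝ) (Q : Matrix μ ν ℝ) (D : Matrix ν σ ℝ) {X : Matrix σ σ ℝ} (hX : Xᵀ = X) (hXd : X.det ≠ 0)
    (N : Matrix σ m ℝ) {c : ℝ} (hc : c ≠ 0) (hG : (Nᵀ * X⁻¹ * X⁻¹ * N).det ≠ 0)
    (hkkt : (kkt (K + c • (D * (1 - (X⁻¹ * N) * ((X⁻¹ * N)ᵀ * (X⁻¹ * N))⁻¹ * (X⁻¹ * N)ᵀ) * Dᵀ)) Q).det ≠ 0) :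
    Real.log |(fromBlocks
        (fromBlocks (kkt (K + c • (D * Dᵀ)) Q) (0 : Matrix (ν ⊕ μ) m ℝ) (0 : Matrix m (ν ⊕ μ) ℝ) (0 : Matrix m m ℝ))
        (fromCols (fromRows (fromRows (-(c • D)) (0 : Matrix μ σ ℝ)) (0 : Matrix m σ ℝ))
          (fromRows (fromRows (0 : Matrix ν σ ℝ) (0 : Matrix μ σ ℝ)) (-Nᵀ)))
        (fromRows (fromRows (fromRows (-(c • D)) (0 : Matrix μ σ ℝ)) (0 : Matrix m σ ℝ))ᵀ
          (fromRows (fromRows (0 : Matrix ν σ ℝ) (0 : Matrix μ σ ℝ)) (-Nᵀ))ᵀ)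
        (fromBlocks (c • (1 : Matrix σ σ ℝ)) X X 0)).det|
      = 2 * Real.log |X.det| + Real.log |(c • ((X⁻¹ * N)ᵀ * (X⁻¹ * N))).det|
        + Real.log |(kkt (K + c • (D * (1 - (X⁻¹ * N) * ((X⁻¹ * N)ᵀ * (X⁻¹ * N))⁻¹ * (X⁻¹ * N)ᵀ) * Dᵀ)) Q).det| := by
  have hMt : (X⁻¹ * N)ᵀ = Nᵀ * X⁻¹ := by rw [transpose_mul, transpose_nonsing_inv, hX]
  have hGd : ((X⁻¹ * N)ᵀ * (X⁻¹ * N)).det ≠ 0 := by rw [hMt, ← Matrix.mul_assoc]; exact hG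
  rw [det_frame_eq_det_kkt K Q D hX (isUnit_iff_ne_zero.mpr hXd) N hc (isUnit_iff_ne_zero.mpr hG)]
  have h1 : |((-1 : ℝ) ^ Fintype.card σ)| = 1 := by rw [abs_pow, abs_neg, abs_one, one_pow]
  have h2 : |(c • ((X⁻¹ * N)ᵀ * (X⁻¹ * N))).det| ≠ 0 := by
    rw [det_smul]; exact abs_ne_zero.mpr (mul_ne_zero (pow_ne_zero _ hc) hGd)
  have hX2 : |X.det ^ 2| ≠ 0 := abs_ne_zero.mpr (pow_ne_zero _ hXd)
  rw [abs_mul, abs_mul, abs_mul, h1, one_mul, Real.log_mul (mul_ne_zero hX2 h2) (abs_ne_zero.mpr hkkt),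
    Real.log_mul hX2 h2, abs_pow, Real.log_pow]
  push_cast
  ring

end Real

end Summit.QuantumFields.BalabanUV.Beta.D1BFx.LocalisedFrameBlocks
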